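import Literature.Analysis.FluidPDE.DissipationAnomalyProofs
import Mathlib.MeasureTheory.Measure.HasOuterApproxClosed
import HarnessLib

/-!
# Uniqueness of the dissipation measure of a vanishing-viscosity sequence: discharge of `IsDissipationMeasureOf.unique`

Analysis/FluidPDE proof file; sibling of `DissipationAnomaly` (the named fact
`Torus.IsDissipationMeasureOf.unique`: two dissipation measures of the same sequence `(ν_m, u_m)`
on `[0,T] × T^d` coincide; DiPerna–Majda 1987, §1; Billingsley, *Convergence of probability
measures*, Thm. 1.2) and of `DissipationAnomalyProofs` (`Torus.HasWeakGradient.unique_holds`).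
This file PROVES the fact (`IsDissipationMeasureOf.unique_holds`) exactly along its docstring: the
two chosen weak gradients agree a.e. in `x` for a.e. `t ∈ (0,T)` (`HasWeakGradient.unique_holds`),
hence — both being jointly a.e.-strongly measurable on `[0,T] × T^d`, and `{0, T} × T^d` being
null — a.e. on `[0,T] × T^d` (`ae_eq_restrict_Icc_prod_of_ae_Ioo`, Tonelli through strongly
measurable representatives); so the approximating measures `ν_m|∇u_m|² dx dt` coincide
(`withDensity_congr_ae`), and two weak limits of one sequence of finite Borel measures on the
metrisable space `ℝ × T^d` agree on all bounded continuous functions, hence are equal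
(Mathlib's `ext_of_forall_integral_eq_of_IsFiniteMeasure`).

## References

* R. J. DiPerna, A. J. Majda, Comm. Math. Phys. 108 (1987), §1. [DiPernaMajda1987]
* P. Billingsley, *Convergence of probability measures*, 2nd ed. (1999), Thm. 1.2. [Billingsley1999]
-/

noncomputable section

open MeasureTheory Set Filter Topology Function
open scoped ENNReal NNReal BoundedContinuousFunction

namespace Literature.Analysis.FluidPDE.Torus

variable {d : Type*} [Fintype d]

/-- **Slice-wise a.e. equality on `(0,T)` gives a.e. equality on `[0,T] × T^d`** for jointly
a.e.-strongly measurable functions: pass to strongly measurable representatives (whose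
coincidence set is measurable), use Tonelli (`Measure.ae_prod_mem_iff_ae_ae_mem`), and
`(0,T) =ᵐ [0,T]`. [folklore] -/
theorem ae_eq_restrict_Icc_prod_of_ae_Ioo {G' : Type*} [TopologicalSpace G'] [TopologicalSpace.MetrizableSpace G']
    {T : ℝ} {f g : ℝ × UnitAddTorus d → G'}
    (hf : AEStronglyMeasurable f (volume.restrict (Icc 0 T ×ˢ univ)))
    (hg : AEStronglyMeasurable g (volume.restrict (Icc 0 T ×ˢ univ)))
    (h : ∀ᵐ t ∂(volume.restrict (Ioo 0 T)), ∀ᵐ x ∂(volume : Measure (UnitAddTorus d)), f (t, x) = g (t, x)) :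
    f =ᵐ[volume.restrict (Icc 0 T ×ˢ univ)] g := by
  have hμ : (volume : Measure (ℝ × UnitAddTorus d)).restrict (Icc 0 T ×ˢ univ) =
      ((volume : Measure ℝ).restrict (Icc 0 T)).prod (volume : Measure (UnitAddTorus d)) := by
    rw [Measure.volume_eq_prod, ← Measure.restrict_prod_eq_prod_univ]
  rw [hμ] at hf hg ⊢
  -- `(0,T) =ᵐ [0,T]`
  have hI : (volume : Measure ℝ).restrict (Ioo 0 T) = volume.restrict (Icc 0 T) :=
    Measure.restrict_congr_set Ioo_ae_eq_Icc
  rw [hI] at h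
  have h1 : ∀ᵐ t ∂(volume.restrict (Icc 0 T)), ∀ᵐ x ∂(volume : Measure (UnitAddTorus d)), f (t, x) = hf.mk f (t, x) :=
    Measure.ae_ae_of_ae_prod hf.ae_eq_mk
  have h2 : ∀ᵐ t ∂(volume.restrict (Icc 0 T)), ∀ᵐ x ∂(volume : Measure (UnitAddTorus d)), g (t, x) = hg.mk g (t, x) :=
    Measure.ae_ae_of_ae_prod hg.ae_eq_mk
  have hS : MeasurableSet {z | hf.mk f z = hg.mk g z} :=
    hf.stronglyMeasurable_mk.measurableSet_eq_fun hg.stronglyMeasurable_mk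
  have h3 : ∀ᵐ t ∂(volume.restrict (Icc 0 T)), ∀ᵐ x ∂(volume : Measure (UnitAddTorus d)),
      (t, x) ∈ {z | hf.mk f z = hg.mk g z} := by
    filter_upwards [h, h1, h2] with t ht h1t h2t
    filter_upwards [ht, h1t, h2t] with x hx h1x h2x
    show hf.mk f (t, x) = hg.mk g (t, x)
    rw [← h1x, ← h2x, hx]
  have h4 : ∀ᵐ z ∂(((volume : Measure ℝ).restrict (Icc 0 T)).prod (volume : Measure (UnitAddTorus d))),
      z ∈ {z | hf.mk f z = hg.mk g z} :=
    (Measure.ae_prod_mem_iff_ae_ae_mem hS).2 h3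
  filter_upwards [h4, hf.ae_eq_mk, hg.ae_eq_mk] with z hz hfz hgz
  rw [hfz, hgz]
  exact hz

variable {T : ℝ}

/-- **Discharge of `Torus.IsDissipationMeasureOf.unique`**: two dissipation measures of the same
vanishing-viscosity sequence coincide. [cite: DiPernaMajda1987, §1] -/
theorem IsDissipationMeasureOf.unique_holds : IsDissipationMeasureOf.unique (d := d) (T := T) := by
  intro _ νseq useq D D' h h'
  obtain ⟨G, hGm, hGw, -, hDfin, hlim⟩ := h
  obtain ⟨G', hG'm, hG'w, -, hD'fin, hlim'⟩ := h'
  -- the approximating measures coincide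
  have heq : ∀ m, dissipationMeasure (νseq m) (G m) T = dissipationMeasure (νseq m) (G' m) T := by
    intro m
    have hae : ∀ᵐ t ∂(volume.restrict (Ioo 0 T)), ∀ᵐ x ∂(volume : Measure (UnitAddTorus d)),
        uncurry (G m) (t, x) = uncurry (G' m) (t, x) := by
      filter_upwards [hGw m, hG'w m] with t ht ht'
      exact HasWeakGradient.unique_holds ht.2 ht'.2 ht.1 ht'.1
    have hGG' : uncurry (G m) =ᵐ[volume.restrict (Icc 0 T ×ˢ univ)] uncurry (G' m) :=
      ae_eq_restrict_Icc_prod_of_ae_Ioo (hGm m) (hG'm m) hae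
    unfold dissipationMeasure
    refine withDensity_congr_ae ?_
    filter_upwards [hGG'] with z hz
    simp only [uncurry] at hz
    simp only [weakGradNormSq, hz]
  -- the two weak limits agree on bounded continuous functions
  have hint : ∀ g : (ℝ × UnitAddTorus d) →ᵇ ℝ, ∫ z, g z ∂D = ∫ z, g z ∂D' := fun g => by
    have h2 : Tendsto (fun m => ∫ z, g z ∂(dissipationMeasure (νseq m) (G m) T)) atTop (𝓝 (∫ z, g z ∂D')) := by
      simpa only [heq] using hlim' g
    exact tendsto_nhds_unique (hlim g) h2
  haveI := hDfin
  haveI := hD'fin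
  exact ext_of_forall_integral_eq_of_IsFiniteMeasure hint

end Literature.Analysis.FluidPDE.Torus
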